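import Mathlib
import Summits.NavierStokesRegularity.FluidComputer.LayerNormalRim

/-!
# Ring aperture: the (J6) line of `LayerNormalRim` §9 is a chord of the level-one ring; the level-two SUP sits inside the aperture — chord
# identities and the record

Cell `pub-fluidc` (FLUID COMPUTER; host summit `NavierStokesRegularity`, negation side, machine paradigm), prover seat p1 (gen 24, 2026-08-27).
HONEST FRAMING: low prior, high value-of-information experiment on Tao's machine paradigm; NOT a claim that NS blows up.
Nothing here is about the Navier–Stokes equations. Reader `pub-fluidc-p1/tools/ring_aperture.py` 0.1.0 (deposit
`atlas/rung-next/p1/spatial/floor-window/RING-APERTURE.md`, README ADDENDUM L; HOME/STATUS p1 gen 24 INFORMATION #18). The instrument fits a CENTRELINE CIRCLE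
(centre `C`, unit axis `a`, radius `R`) in 3-D to the high-`|ω₁|` set of the three deposited `@out` planes through the [5,9) argmax (the RIM), axis constrained ⊥ the
rim's vorticity vector, and reads every point of record in cylindrical coordinates `(ρ/R, ζ/R, φ)`. §1 is the geometry the reading rests on: along a line
`s ↦ w + s • m` the squared distance is a quadratic in `s` (`lineSq_eq`); if the line meets the sphere / cylinder `‖·‖ = R` at parameters `s₁ < s₂` then every
parameter strictly between them is strictly INSIDE (`inside_of_between_crossings`) and the midpoint `(s₁ + s₂)/2` is the line's closest approach to the centre
(`midpoint_is_closest`); a chord is at most a diameter; a line starting on the circle re-crosses at `s* = −2⟪w, m⟫/‖m‖²`; unit tangents of one circle at azimuths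
`φ₁, φ₂` have inner product `cos (φ₁ − φ₂)` (the ring's predicted cosine between its vorticity vectors; `−1` half a turn round). §2–§6 are the record (window instant,
hundredths; rings D-128 / D-192 / E, then F, G; arcs A-128 / B / C / A-192 / A-256): the fitted axis lies along the band-one jet (cos ≥ 0.95, not used in the fit), the
wall is sleeve-like on the rings (axial / radial scatter 1.85–1.90), the loop is lit wherever the planes see it on the rings and dark over a quadrant on the arcs; the
near `|ω₁|` wall is the rim's own ridge (|φ| ≤ 18°), the far wall the same ridge half a turn round (|φ| ≥ 160°), the `|u₁|` hump and both bands' velocity maxima sit on the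
axis (ρ/R ≤ 0.27), the SUP INSIDE the aperture at ρ/R 0.43–0.53 toward the far rim; the chord's closest approach coincides with the hump of record to 0.008; on the arcs the
SUP is outside (ρ/R ≥ 1.70, above the plane); along the clock the ring persists while the SUP rides in and out. Words: none. 0 sorry.
-/

noncomputable section

open Set
open scoped InnerProductSpace

namespace Summit.NavierStokesRegularity.FluidComputer.RingAperture

/-! ## §1 Chord identities (real inner product space) -/

variable {E : Type*} [NormedAddCommGroup E] [InnerProductSpace ℝ E]

/-- Squared distance from the centre along the line `s ↦ w + s • m` (`w` = start point minus centre). -/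
def lineSq (w m : E) (s : ℝ) : ℝ := ‖w + s • m‖ ^ 2

/-- **THE SQUARED DISTANCE ALONG A LINE IS A QUADRATIC**: `‖w + s m‖² = ‖w‖² + 2 s ⟪w, m⟫ + s² ‖m‖²`. -/
theorem lineSq_eq (w m : E) (s : ℝ) : lineSq w m s = ‖w‖ ^ 2 + 2 * s * ⟪w, m⟫_ℝ + s ^ 2 * ‖m‖ ^ 2 := by
  unfold lineSq
  rw [norm_add_sq_real, inner_smul_right, norm_smul, mul_pow, Real.norm_eq_abs, sq_abs]
  ring

/-- **A QUADRATIC WITH POSITIVE LEADING COEFFICIENT IS NEGATIVE STRICTLY BETWEEN ITS TWO ROOTS.** -/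
theorem quad_neg_between {a b c s₁ s₂ s : ℝ} (ha : 0 < a) (h₁ : a * s₁ ^ 2 + b * s₁ + c = 0) (h₂ : a * s₂ ^ 2 + b * s₂ + c = 0)
    (hlt : s₁ < s₂) (hs₁ : s₁ < s) (hs₂ : s < s₂) : a * s ^ 2 + b * s + c < 0 := by
  have hb : b = -a * (s₁ + s₂) := by
    have hprod : (s₂ - s₁) * (a * (s₁ + s₂) + b) = 0 := by linear_combination h₂ - h₁
    have hne : s₂ - s₁ ≠ 0 := sub_ne_zero.mpr (ne_of_gt hlt)
    have h0 := (mul_eq_zero.mp hprod).resolve_left hne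
    linarith
  have hc : c = a * s₁ * s₂ := by
    subst hb
    linear_combination h₁
  have hfac : a * s ^ 2 + b * s + c = a * ((s - s₁) * (s - s₂)) := by
    subst hb; subst hc; ring
  rw [hfac]
  exact mul_neg_of_pos_of_neg ha (mul_neg_of_pos_of_neg (sub_pos.mpr hs₁) (sub_neg.mpr hs₂))

/-- **THE VALUES OF A QUADRATIC WITH TWO ROOTS, RELATIVE TO THE MIDPOINT**: `a s² + b s + c = a (s − (s₁+s₂)/2)² − a ((s₂ − s₁)/2)²`. -/
theorem quad_vertex_form {a b c s₁ s₂ : ℝ} (h₁ : a * s₁ ^ 2 + b * s₁ + c = 0) (h₂ : a * s₂ ^ 2 + b * s₂ + c = 0) (hlt : s₁ < s₂) (s : ℝ) :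
    a * s ^ 2 + b * s + c = a * (s - (s₁ + s₂) / 2) ^ 2 - a * ((s₂ - s₁) / 2) ^ 2 := by
  have hb : b = -a * (s₁ + s₂) := by
    have hprod : (s₂ - s₁) * (a * (s₁ + s₂) + b) = 0 := by linear_combination h₂ - h₁
    have hne : s₂ - s₁ ≠ 0 := sub_ne_zero.mpr (ne_of_gt hlt)
    have h0 := (mul_eq_zero.mp hprod).resolve_left hne
    linarith
  have hc : c = a * s₁ * s₂ := by
    subst hb
    linear_combination h₁
  subst hb; subst hc; ring

/-- **STRICTLY BETWEEN THE TWO WALL CROSSINGS ⇒ STRICTLY INSIDE.** If the line `s ↦ w + s • m` (`m ≠ 0`) is at distance `R` from the centre at parameters `s₁ < s₂`,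
then at every `s` strictly between them it is at distance `< R`. (K3): the level-two SUP sits at `s = 0` between the near-wall and far-wall crossings of the (J6)
line with the ring `ρ = R`, hence inside the aperture. Stated for the norm of a real inner product space; the cylindrical case is the same statement for the projected
vectors `P w`, `P m` (`P` = orthogonal projection onto the ring plane, linear). -/
theorem inside_of_between_crossings (w m : E) {R s₁ s₂ s : ℝ} (hm : m ≠ 0) (h₁ : ‖w + s₁ • m‖ = R) (h₂ : ‖w + s₂ • m‖ = R)
    (hlt : s₁ < s₂) (hs₁ : s₁ < s) (hs₂ : s < s₂) : ‖w + s • m‖ < R := by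
  have hR : 0 ≤ R := by rw [← h₁]; exact norm_nonneg _
  have ha : 0 < ‖m‖ ^ 2 := by positivity
  have q₁ : ‖m‖ ^ 2 * s₁ ^ 2 + (2 * ⟪w, m⟫_ℝ) * s₁ + (‖w‖ ^ 2 - R ^ 2) = 0 := by
    have := lineSq_eq w m s₁; unfold lineSq at this; rw [h₁] at this; linarith
  have q₂ : ‖m‖ ^ 2 * s₂ ^ 2 + (2 * ⟪w, m⟫_ℝ) * s₂ + (‖w‖ ^ 2 - R ^ 2) = 0 := by
    have := lineSq_eq w m s₂; unfold lineSq at this; rw [h₂] at this; linarith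
  have hneg := quad_neg_between ha q₁ q₂ hlt hs₁ hs₂
  have hsq : ‖w + s • m‖ ^ 2 < R ^ 2 := by
    have := lineSq_eq w m s; unfold lineSq at this; linarith
  by_contra hcon
  have hcon' : R ≤ ‖w + s • m‖ := not_lt.mp hcon
  have hmul : R * R ≤ ‖w + s • m‖ * ‖w + s • m‖ := mul_le_mul hcon' hcon' hR (hR.trans hcon')
  nlinarith [hmul, hsq]

/-- **THE MIDPOINT OF THE CHORD IS THE LINE'S CLOSEST APPROACH TO THE CENTRE** (K3's `s_m`: where an axial jet's maximum is predicted on the (J6) line). -/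
theorem midpoint_is_closest (w m : E) {R s₁ s₂ : ℝ} (h₁ : ‖w + s₁ • m‖ = R) (h₂ : ‖w + s₂ • m‖ = R) (hlt : s₁ < s₂) (s : ℝ) :
    ‖w + ((s₁ + s₂) / 2) • m‖ ≤ ‖w + s • m‖ := by
  have q₁ : ‖m‖ ^ 2 * s₁ ^ 2 + (2 * ⟪w, m⟫_ℝ) * s₁ + (‖w‖ ^ 2 - R ^ 2) = 0 := by
    have := lineSq_eq w m s₁; unfold lineSq at this; rw [h₁] at this; linarith
  have q₂ : ‖m‖ ^ 2 * s₂ ^ 2 + (2 * ⟪w, m⟫_ℝ) * s₂ + (‖w‖ ^ 2 - R ^ 2) = 0 := by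
    have := lineSq_eq w m s₂; unfold lineSq at this; rw [h₂] at this; linarith
  have vs := quad_vertex_form q₁ q₂ hlt s
  have vm := quad_vertex_form q₁ q₂ hlt ((s₁ + s₂) / 2)
  have es := lineSq_eq w m s
  have em := lineSq_eq w m ((s₁ + s₂) / 2)
  unfold lineSq at es em
  have hsq : ‖w + ((s₁ + s₂) / 2) • m‖ ^ 2 ≤ ‖w + s • m‖ ^ 2 := by
    have h0 : 0 ≤ ‖m‖ ^ 2 * (s - (s₁ + s₂) / 2) ^ 2 := by positivity
    nlinarith [vs, vm, es, em, h0]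
  by_contra hcon
  have hlt' : ‖w + s • m‖ < ‖w + ((s₁ + s₂) / 2) • m‖ := not_le.mp hcon
  have hmul := mul_self_lt_mul_self (norm_nonneg _) hlt'
  nlinarith [hmul, hsq]

/-- **A CHORD IS AT MOST A DIAMETER**: two points of the line at distance `R` from the centre are at most `2R` apart: `|s₂ − s₁| ‖m‖ ≤ 2R`. -/
theorem chord_le_diameter (w m : E) {R s₁ s₂ : ℝ} (h₁ : ‖w + s₁ • m‖ = R) (h₂ : ‖w + s₂ • m‖ = R) : |s₂ - s₁| * ‖m‖ ≤ 2 * R := by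
  have key : ‖(w + s₂ • m) - (w + s₁ • m)‖ ≤ ‖w + s₂ • m‖ + ‖w + s₁ • m‖ := norm_sub_le _ _
  have hs : (w + s₂ • m) - (w + s₁ • m) = (s₂ - s₁) • m := by rw [sub_smul]; abel
  rw [hs, norm_smul, Real.norm_eq_abs, h₁, h₂] at key
  linarith

/-- **A LINE STARTING ON THE CIRCLE RE-CROSSES IT AT `s* = −2⟪w, m⟫/‖m‖²`** (the RIM's diameter / chord: near wall at `s = 0`, far wall at `s*`). -/
theorem second_crossing (w m : E) {R : ℝ} (hm : m ≠ 0) (hw : ‖w‖ = R) :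
    ‖w + (-(2 * ⟪w, m⟫_ℝ) / ‖m‖ ^ 2) • m‖ ^ 2 = R ^ 2 := by
  have hm2 : ‖m‖ ^ 2 ≠ 0 := by positivity
  have := lineSq_eq w m (-(2 * ⟪w, m⟫_ℝ) / ‖m‖ ^ 2)
  unfold lineSq at this
  rw [this, hw]
  field_simp
  ring

/-- Inner product of the unit tangents `(−sin φ, cos φ)` of one circle at azimuths `φ₁`, `φ₂` (written out in coordinates). -/
def tangentDot (φ₁ φ₂ : ℝ) : ℝ := (-Real.sin φ₁) * (-Real.sin φ₂) + Real.cos φ₁ * Real.cos φ₂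

/-- **THE RING'S PREDICTED COSINE** (K5): azimuthal unit vectors at `φ₁`, `φ₂` make `cos (φ₁ − φ₂)`. -/
theorem tangentDot_eq_cos_sub (φ₁ φ₂ : ℝ) : tangentDot φ₁ φ₂ = Real.cos (φ₁ - φ₂) := by
  unfold tangentDot; rw [Real.cos_sub]; ring

/-- **HALF A TURN ROUND THE TANGENT IS REVERSED**: `cos (φ − (φ + π)) = −1` — the far wall's vorticity is the near wall's, anti-parallel, on ONE loop. -/
theorem tangentDot_half_turn (φ : ℝ) : tangentDot φ (φ + Real.pi) = -1 := by
  rw [tangentDot_eq_cos_sub, show φ - (φ + Real.pi) = -Real.pi by ring, Real.cos_neg, Real.cos_pi]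

/-! ## §2 The fitted frame and closure (window instant; `ring_aperture.py` TABLE 1; hundredths unless said) -/

/-- One leg: 1000·R, 1000·R_pk, 1000·|C − RIM|, 1000·e_ρ, 1000·e_ζ, 100·(e_ζ/e_ρ); signed 100·cos of the axis with û₁(x_u1) / u_full(SUP) / u_rel(SUP); 100·|cos(ω̂₁(RIM), ê_φ)|;
free-fit axis offset (deg); azimuth sectors of 12 holding weight; 100·V (visible fraction), 100·lit fraction, 100·A_min (weakest seen azimuth), 100·far-sector minimum;
closed-consistent flag. -/
structure FrameRow where
  r : ℕ
  rpk : ℕ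
  cRim : ℕ
  eRho : ℕ
  eZeta : ℕ
  ratio : ℕ
  cU1 : ℤ
  cUfull : ℤ
  cUrel : ℤ
  tang : ℕ
  freeDeg : ℕ
  sectors : ℕ
  vis : ℕ
  lit : ℕ
  aMin : ℕ
  farLo : ℕ
  closed : Bool

/-- Rings D-128 / D-192 / E-128, then F-128, G-128 (window 1.30). -/
def frameRingsFG : Fin 5 → FrameRow :=
  ![⟨326, 290, 280, 88, 164, 185, 99, 99, 95, 99, 12, 11, 54, 100, 66, 91, true⟩,
    ⟨323, 283, 273, 87, 164, 190, 99, 99, 91, 99, 12, 11, 58, 100, 65, 90, true⟩,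
    ⟨329, 293, 291, 86, 162, 187, 99, 99, 94, 99, 8, 11, 56, 100, 69, 88, true⟩,
    ⟨329, 282, 271, 110, 160, 146, 96, 94, 98, 98, 6, 11, 75, 100, 53, 94, true⟩,
    ⟨341, 258, 250, 126, 194, 154, 95, 63, -26, 97, 5, 11, 76, 100, 47, 70, false⟩]

/-- Arcs A-128, B-128, C-128, A-192, A-256 (window 1.40). -/
def frameArcs : Fin 5 → FrameRow :=
  ![⟨328, 271, 292, 96, 116, 120, 99, -53, -54, 100, 3, 8, 82, 95, 28, 59, false⟩,
    ⟨324, 302, 297, 83, 114, 137, 99, -11, -18, 100, 0, 8, 64, 89, 17, 38, false⟩,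
    ⟨324, 290, 293, 84, 117, 139, 100, -7, -16, 100, 1, 9, 62, 93, 17, 60, false⟩,
    ⟨324, 275, 293, 90, 115, 128, 99, -23, -26, 100, 5, 8, 79, 91, 23, 60, false⟩,
    ⟨322, 282, 294, 86, 115, 133, 99, -33, -31, 100, 5, 8, 76, 91, 20, 65, false⟩]

/-- **THE FITTED AXIS IS THE BAND-ONE JET** (rings): cos(â, û₁(x_u1)) ≥ 0.99 (a velocity the fit never saw), cos(â, u_full(SUP)) ≥ 0.99, cos(â, u_rel(SUP)) ≥ 0.91
(INFORMATION #17's crossing flow is the ring's axial jet); ω₁(RIM) tangent to the circle (0.99); the high set fills 11 of 12 azimuth sectors; the ridge radius R_pk 0.283–0.293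
(RING.md's 0.295) sits inside the least-squares R 0.323–0.329. -/
theorem rings_axis_is_the_jet (i : Fin 3) :
    99 ≤ (frameRingsFG i.castSucc.castSucc).cU1 ∧ 99 ≤ (frameRingsFG i.castSucc.castSucc).cUfull ∧ 91 ≤ (frameRingsFG i.castSucc.castSucc).cUrel ∧
      99 ≤ (frameRingsFG i.castSucc.castSucc).tang ∧ (frameRingsFG i.castSucc.castSucc).sectors = 11 ∧
      283 ≤ (frameRingsFG i.castSucc.castSucc).rpk ∧ (frameRingsFG i.castSucc.castSucc).rpk ≤ 293 ∧
      (frameRingsFG i.castSucc.castSucc).rpk + 30 ≤ (frameRingsFG i.castSucc.castSucc).r ∧ (frameRingsFG i.castSucc.castSucc).r ≤ 329 := by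
  fin_cases i <;> simp [frameRingsFG]

/-- **THE RINGS' WALL IS SLEEVE-LIKE**: axial scatter 0.162–0.164 vs radial 0.086–0.088, ratio 1.85–1.90 (synthetic round-cored torus 1.08); the arcs read 1.20–1.39. -/
theorem rings_wall_sleeve_like (i : Fin 3) (j : Fin 5) :
    185 ≤ (frameRingsFG i.castSucc.castSucc).ratio ∧ (frameRingsFG i.castSucc.castSucc).ratio ≤ 190 ∧ (frameArcs j).ratio ≤ 139 ∧ 120 ≤ (frameArcs j).ratio := by
  constructor
  · fin_cases i <;> simp [frameRingsFG]
  constructor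
  · fin_cases i <;> simp [frameRingsFG]
  fin_cases j <;> simp [frameArcs]

/-- **ON THE RINGS THE LOOP IS LIT WHEREVER THE PLANES SEE; ON THE ARCS A SEEN AZIMUTH IS DARK.** Rings and F: closed-consistent, lit at 100 % of the 54–75 % of azimuths
seen, weakest seen azimuth ≥ 0.53 W₁, far sector ≥ 0.88; arcs: not closed, a seen azimuth at ≤ 0.28 W₁. -/
theorem rings_closed_arcs_open (i : Fin 4) (j : Fin 5) :
    (frameRingsFG i.castSucc).closed = true ∧ (frameRingsFG i.castSucc).lit = 100 ∧ 53 ≤ (frameRingsFG i.castSucc).aMin ∧ 88 ≤ (frameRingsFG i.castSucc).farLo ∧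
      54 ≤ (frameRingsFG i.castSucc).vis ∧ (frameArcs j).closed = false ∧ (frameArcs j).aMin ≤ 28 := by
  constructor
  · fin_cases i <;> simp [frameRingsFG]
  refine ⟨?_, ?_, ?_, ?_, ?_, ?_⟩
  · fin_cases i <;> simp [frameRingsFG]
  · fin_cases i <;> simp [frameRingsFG]
  · fin_cases i <;> simp [frameRingsFG]
  · fin_cases i <;> simp [frameRingsFG]
  · fin_cases j <;> simp [frameArcs]
  · fin_cases j <;> simp [frameArcs]

/-- **THE ARCS' LOOP IS ALSO AROUND A JET** — cos(â, û₁(x_u1)) ≥ 0.99 — but the flow at their SUP is NOT the jet: cos(â, u_full(SUP)) ≤ −0.07, cos(â, u_rel) ≤ −0.16. -/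
theorem arcs_jet_but_sup_flow_is_not (j : Fin 5) :
    99 ≤ (frameArcs j).cU1 ∧ (frameArcs j).cUfull ≤ -7 ∧ (frameArcs j).cUrel ≤ -16 := by
  fin_cases j <;> simp [frameArcs]

/-! ## §3 Registration in the ring's cylindrical frame (rings, window; `ring_aperture.py` TABLE 2; entries 100·ρ/R, 100·ζ/R, φ in degrees) -/

/-- One point of record in the frame: 100·ρ/R, 100·ρ/R_pk, 100·ζ/R (signed), azimuth from the RIM (degrees, signed). -/
structure Cyl where
  rho : ℕ
  rhoPk : ℕ
  zeta : ℤ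
  phi : ℤ

/-- One ring leg at the window: x_u1 (band-one velocity argmax), SUP, x_u2 (band-two velocity argmax), mw2 (level one's far pick), and the (J6) landmarks of record
`X = SUP + s n̂`: near |ω₁| wall, |u₁| hump, far |ω₁| wall, inner crest, outer crest. -/
structure RegRow where
  xu1 : Cyl
  sup : Cyl
  xu2 : Cyl
  mw2 : Cyl
  near : Cyl
  hump : Cyl
  far : Cyl
  inner : Cyl
  outer : Cyl

/-- Rings D-128 / D-192 / E-128 (window 1.30). -/
def regRings : Fin 3 → RegRow :=
  ![⟨⟨27, 30, -9, 94⟩, ⟨53, 59, -19, -151⟩, ⟨11, 13, -9, -146⟩, ⟨108, 121, 14, -166⟩, ⟨76, 85, 6, -16⟩, ⟨24, 27, -9, -93⟩, ⟨81, 91, -25, -160⟩, ⟨37, 41, -3, -39⟩,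
      ⟨130, 146, -36, -167⟩⟩,
    ⟨⟨18, 20, -7, 76⟩, ⟨53, 61, -16, -158⟩, ⟨14, 16, -11, -110⟩, ⟨112, 128, 18, -158⟩, ⟨83, 95, 5, -18⟩, ⟨22, 25, -8, -89⟩, ⟨80, 92, -20, -167⟩, ⟨40, 45, -3, -36⟩,
      ⟨129, 147, -28, -173⟩⟩,
    ⟨⟨25, 28, -10, 89⟩, ⟨43, 49, -26, -177⟩, ⟨6, 7, -24, -53⟩, ⟨106, 119, 19, -159⟩, ⟨77, 86, -4, -13⟩, ⟨8, 9, -18, -84⟩, ⟨73, 82, -32, 179⟩, ⟨33, 37, -12, -21⟩,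
      ⟨118, 132, -40, 176⟩⟩]

/-- **THE LEVEL-TWO SUP SITS INSIDE THE RING'S APERTURE** (rings, window): ρ/R 0.43–0.53 (< 1; ρ/R_pk 0.49–0.61), |ζ/R| ≤ 0.26 (≤ e/R 0.57), on the far side (|φ| ≥ 151°). -/
theorem sup_inside_aperture (i : Fin 3) :
    43 ≤ (regRings i).sup.rho ∧ (regRings i).sup.rho ≤ 53 ∧ (regRings i).sup.rhoPk ≤ 61 ∧ -26 ≤ (regRings i).sup.zeta ∧ (regRings i).sup.zeta ≤ -16 ∧
      ((regRings i).sup.phi ≤ -151 ∨ 151 ≤ (regRings i).sup.phi) := by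
  fin_cases i <;> simp [regRings]

/-- **THE NEAR WALL IS THE RIM'S OWN RIDGE, THE FAR WALL THE SAME RIDGE HALF A TURN ROUND**: near |ω₁| wall at ρ/R_pk 0.85–0.95, |ζ/R| ≤ 0.06, |φ| ≤ 18°; far |ω₁| wall at
ρ/R_pk 0.82–0.92, |φ| ≥ 160°; both inside the least-squares R (ρ/R 0.73–0.83: the ridge sits inside the mean radius of a thick wall). -/
theorem walls_are_one_ridge (i : Fin 3) :
    85 ≤ (regRings i).near.rhoPk ∧ (regRings i).near.rhoPk ≤ 95 ∧ -6 ≤ (regRings i).near.zeta ∧ (regRings i).near.zeta ≤ 6 ∧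
      -18 ≤ (regRings i).near.phi ∧ (regRings i).near.phi ≤ 18 ∧
      82 ≤ (regRings i).far.rhoPk ∧ (regRings i).far.rhoPk ≤ 92 ∧ ((regRings i).far.phi ≤ -160 ∨ 160 ≤ (regRings i).far.phi) ∧
      (regRings i).near.rho ≤ 83 ∧ (regRings i).far.rho ≤ 81 := by
  fin_cases i <;> simp [regRings]

/-- **THE |u₁| HUMP AND BOTH BANDS' VELOCITY MAXIMA SIT ON THE AXIS**: hump ρ/R ≤ 0.24, x_u1 ≤ 0.27, x_u2 ≤ 0.14 — inside; the packet's inner crest inside (≤ 0.40), its outer crest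
beyond the far rim (≥ 1.18 at |φ| ≥ 167°); level one's far pick mw2 on the loop's far side just outside the mean radius (1.06–1.12, |φ| 158–166). -/
theorem axis_points_and_crests (i : Fin 3) :
    (regRings i).hump.rho ≤ 24 ∧ (regRings i).xu1.rho ≤ 27 ∧ (regRings i).xu2.rho ≤ 14 ∧ (regRings i).inner.rho ≤ 40 ∧ 118 ≤ (regRings i).outer.rho ∧
      ((regRings i).outer.phi ≤ -167 ∨ 167 ≤ (regRings i).outer.phi) ∧ 106 ≤ (regRings i).mw2.rho ∧ (regRings i).mw2.rho ≤ 112 ∧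
      -166 ≤ (regRings i).mw2.phi ∧ (regRings i).mw2.phi ≤ -158 := by
  fin_cases i <;> simp [regRings]

/-- The far pick's vorticity against the RIM's (rings D-128 / D-192 / E, then arcs A-128 / B / C / A-192 / A-256): 100·|cos(ω̂₁(mw2), ê_φ(mw2))| (tangency), the ring's
PREDICTED 100·cos(ω₁(mw2), ω₁(RIM)) = 100·cos Δφ, and the MEASURED signed cosine of the two vectors of record. -/
def farPick : Fin 8 → ℕ × ℤ × ℤ :=
  ![(99, -97, -96), (97, -93, -95), (95, -93, -96), (100, -96, -97), (100, -97, -95), (89, -100, -93), (100, -95, -96), (98, -100, -94)]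

/-- **PACKET-PARITY'S 'ANTI FAR SIDE' IS THE OPPOSITE SIDE OF ONE AZIMUTHAL LOOP**: ω₁ at mw2 is tangent to the fitted circle (≥ 0.89) and the ring-predicted cosine
cos Δφ matches the measured one within 0.07 on all eight legs (rings AND arcs), both ≤ −0.93. -/
theorem far_pick_is_opposite_side (i : Fin 8) :
    89 ≤ (farPick i).1 ∧ (farPick i).2.1 ≤ -93 ∧ (farPick i).2.2 ≤ -93 ∧ (farPick i).2.1 - (farPick i).2.2 ≤ 7 ∧ (farPick i).2.2 - (farPick i).2.1 ≤ 7 := by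
  fin_cases i <;> simp [farPick]

/-! ## §4 The chord (rings + F, window; `ring_aperture.py` TABLE 3; thousandths of a box unit) -/

/-- One leg: 100·|n̂·â|, 100·b/R (the (J6) line's distance from the axis / R); predicted crossings 1000·s₋ / 1000·s₊ with ρ = R and with ρ = R_pk; 1000·s_m (closest
approach); the walls / hump OF RECORD (1000·s_near, 1000·s_hump, 1000·s_far, `LayerNormalRim` §9); residuals 1000·(s_m − s_hump), and vs R_pk 1000·(s₋ − s_near), 1000·(s₊ − s_far) (each rounded from the unrounded values). -/
structure ChordRow where
  nDotA : ℕ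
  bR : ℕ
  sMinus : ℤ
  sPlus : ℤ
  sMinusPk : ℤ
  sPlusPk : ℤ
  sMid : ℤ
  recNear : ℤ
  recHump : ℤ
  recFar : ℤ
  dHump : ℤ
  dNearPk : ℤ
  dFarPk : ℤ

/-- Rings D-128 / D-192 / E-128, then F-128. -/
def chordRingsF : Fin 4 → ChordRow :=
  ![⟨21, 24, -479, 168, -441, 130, -155, -395, -148, 100, -8, -46, 29⟩,
    ⟨15, 22, -477, 161, -435, 119, -158, -422, -163, 95, 5, -14, 24⟩,
    ⟨18, 8, -475, 191, -439, 154, -142, -398, -149, 101, 6, -41, 53⟩,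
    ⟨30, 17, -476, 203, -426, 154, -136, -391, -142, 107, 6, -35, 47⟩]

/-- **THE (J6) LINE IS A NEAR-DIAMETRAL CHORD AND THE SUP LIES STRICTLY BETWEEN ITS WALL CROSSINGS**: |n̂·â| ≤ 0.30 (≤ 0.21 on the rings: ≤ 12° off the ring plane),
distance from the axis ≤ 0.24 R, and s₋ < s_near < 0 < s_far < s₊ on every row (the SUP is s = 0; `inside_of_between_crossings`); the record's walls sit inside the
least-squares circle on both sides. -/
theorem sup_between_crossings (i : Fin 4) :
    (chordRingsF i).nDotA ≤ 30 ∧ (chordRingsF i).bR ≤ 24 ∧ (chordRingsF i).sMinus < (chordRingsF i).recNear ∧ (chordRingsF i).recNear < 0 ∧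
      0 < (chordRingsF i).recFar ∧ (chordRingsF i).recFar < (chordRingsF i).sPlus ∧
      (chordRingsF i).sMinusPk < 0 ∧ 0 < (chordRingsF i).sPlusPk := by
  fin_cases i <;> simp [chordRingsF]

/-- **THE |u₁| HUMP OF RECORD IS WHERE THE LINE PASSES THE AXIS, TO 0.008; THE WALLS OF RECORD SIT ON THE RIDGE CIRCLE TO 0.053.** -/
theorem hump_at_closest_approach (i : Fin 4) :
    -8 ≤ (chordRingsF i).dHump ∧ (chordRingsF i).dHump ≤ 6 ∧ -46 ≤ (chordRingsF i).dNearPk ∧ (chordRingsF i).dNearPk < 0 ∧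
      0 < (chordRingsF i).dFarPk ∧ (chordRingsF i).dFarPk ≤ 53 := by
  fin_cases i <;> simp [chordRingsF]

/-! ## §5 The arcs' SUP is outside the loop (window 1.40; TABLE 2) -/

/-- One arc leg: SUP 100·ρ/R, 100·ζ/R, φ; x_u1 100·ρ/R; x_u2 100·ρ/R; 100·|n̂·â| of its (J6) line. -/
def arcSup : Fin 5 → ℕ × ℤ × ℤ × ℕ × ℕ × ℕ :=
  ![(188, 60, -74, 23, 243, 90), (185, 48, -71, 38, 261, 93), (170, 38, -67, 48, 249, 93), (175, 53, -73, 36, 255, 91), (173, 48, -72, 39, 252, 92)]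

/-- **ON THE ARCS THE SUP IS NOT IN A RING**: ρ/R 1.70–1.88 (outside), ζ/R +0.38…+0.60 (above the plane), φ −74…−67° (along the RIM's tangent), the band-two velocity
argmax 2.4–2.6 R away, the (J6) line ≥ 64° off the ring plane (|n̂·â| ≥ 0.90) — while the band-one jet is still near the axis (x_u1 ≤ 0.48 R). -/
theorem arcs_sup_outside_loop (j : Fin 5) :
    170 ≤ (arcSup j).1 ∧ 38 ≤ (arcSup j).2.1 ∧ -74 ≤ (arcSup j).2.2.1 ∧ (arcSup j).2.2.1 ≤ -67 ∧ (arcSup j).2.2.2.1 ≤ 48 ∧ 243 ≤ (arcSup j).2.2.2.2.1 ∧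
      90 ≤ (arcSup j).2.2.2.2.2 := by
  fin_cases j <;> simp [arcSup]

/-! ## §6 Along the clock (rings D-128 / E-128 / D-192 and F; TABLE 1–2 at every deposited instant) -/

/-- One instant: 100·t, leg (0 = D-128, 1 = E-128, 2 = D-192, 3 = F-128), SUP 100·ρ/R, 100·ζ/R, φ, inside flag, closed-consistent flag, 1000·R_pk, x_u1 100·ρ/R. -/
structure ClockRow where
  t : ℕ
  leg : ℕ
  rho : ℕ
  zeta : ℤ
  phi : ℤ
  inside : Bool
  closed : Bool
  rpk : ℕ
  xu1 : ℕ

/-- D-128 at 1.30 / 2.00 / 2.10 / 2.35; E at 1.30 / 1.80 / 2.00 / 2.20 / 2.60; D-192 at 1.30 / 2.05 / 2.75; F at 1.30 / 1.80 / 2.00 / 2.20 / 2.60. -/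
def clockRings : Fin 17 → ClockRow :=
  ![⟨130, 0, 53, -19, -151, true, true, 290, 27⟩, ⟨200, 0, 119, -15, -77, false, true, 283, 12⟩, ⟨210, 0, 40, 6, -96, true, true, 283, 15⟩,
    ⟨235, 0, 52, 20, 20, true, true, 276, 10⟩,
    ⟨130, 1, 43, -26, -177, true, true, 293, 25⟩, ⟨180, 1, 132, -34, 90, false, true, 275, 6⟩, ⟨200, 1, 120, -22, -79, false, true, 292, 11⟩,
    ⟨220, 1, 49, 14, -125, true, true, 283, 8⟩, ⟨260, 1, 158, 36, -158, false, true, 271, 8⟩,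
    ⟨130, 2, 53, -16, -158, true, true, 283, 18⟩, ⟨205, 2, 39, 9, -98, true, true, 292, 8⟩, ⟨275, 2, 164, 48, -175, false, true, 284, 10⟩,
    ⟨130, 3, 43, 19, 165, true, true, 282, 34⟩, ⟨180, 3, 47, 14, 26, true, true, 266, 5⟩, ⟨200, 3, 46, 14, 19, true, true, 263, 3⟩,
    ⟨220, 3, 45, 59, -159, false, true, 257, 6⟩, ⟨260, 3, 160, -19, 57, false, true, 259, 6⟩]

/-- **THE RING PERSISTS WHILE THE SUP RIDES THE CLOCK**: at every deposited instant of D-128 / E / D-192 / F the level-one loop is closed-consistent with ridge radius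
0.257–0.293 and the band-one jet within 0.34 R of the axis (≤ 0.15 R from 1.80 on); the SUP is inside at the window on all four. -/
theorem ring_persists (i : Fin 17) :
    (clockRings i).closed = true ∧ 257 ≤ (clockRings i).rpk ∧ (clockRings i).rpk ≤ 293 ∧ (clockRings i).xu1 ≤ 34 ∧
      (180 ≤ (clockRings i).t → (clockRings i).xu1 ≤ 15) ∧ ((clockRings i).t = 130 → (clockRings i).inside = true) := by
  fin_cases i <;> simp [clockRings]

/-- **AT THE RELOCATION ROWS (2.00, D-128 / E) THE SUP SITS ON THE WALL'S OUTER FLANK A QUARTER TURN FROM THE RIM, THEN INSIDE AGAIN** (LEAD NOTE 20 ADDENDUM 4 (A) in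
ring coordinates): t = 2.00 on legs D-128 / E ⇒ ρ/R 1.19–1.20, |φ| 77–79°, not inside; the next deposited ring instant (2.10 D-128, 2.20 E, 2.05 D-192) ⇒ inside at
ρ/R 0.39–0.49. -/
theorem sup_on_outer_flank_at_relocation :
    (clockRings 1).rho = 119 ∧ (clockRings 1).phi = -77 ∧ (clockRings 1).inside = false ∧ (clockRings 6).rho = 120 ∧ (clockRings 6).phi = -79 ∧
      (clockRings 6).inside = false ∧ (clockRings 2).inside = true ∧ (clockRings 2).rho = 40 ∧ (clockRings 7).inside = true ∧ (clockRings 7).rho = 49 ∧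
      (clockRings 10).inside = true ∧ (clockRings 10).rho = 39 := by
  simp [clockRings]

/-! ## §7 The pre-stated tests (P1)–(P8) at the window and their reading against the ridge radius (TABLE 5) -/

/-- One leg: P1..P8 as pre-stated (against the least-squares R), then P1pk / P2pk / P4pk / P6pk (against R_pk, post-hoc, labelled). -/
def testsRingsF : Fin 4 → List Bool × List Bool :=
  ![([true, false, true, true, true, false, true, true], [true, true, true, true]),
    ([true, true, true, true, true, true, true, true], [true, true, true, true]),
    ([false, false, true, true, true, false, true, true], [true, true, true, true]),
    ([false, false, true, true, false, false, true, true], [true, true, true, true])]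

/-- **D-192 PASSES 8/8 AS STATED; EVERY RING PASSES P3 / P4 (SUP INSIDE) / P5 / P7 / P8 AS STATED AND 4/4 AGAINST THE RIDGE RADIUS; THE MISSES ARE P1 / P2 / P6 ONLY**
(the thick wall's least-squares radius sits 12–15 % outside the ridge — one disclosed systematic; F also misses P5 at 18°). -/
theorem tests_record (i : Fin 3) :
    (testsRingsF 1).1 = [true, true, true, true, true, true, true, true] ∧ (testsRingsF i.castSucc).2 = [true, true, true, true] ∧
      (testsRingsF i.castSucc).1.getD 2 false = true ∧ (testsRingsF i.castSucc).1.getD 3 false = true ∧ (testsRingsF i.castSucc).1.getD 4 false = true ∧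
      (testsRingsF i.castSucc).1.getD 6 false = true ∧ (testsRingsF i.castSucc).1.getD 7 false = true ∧ (testsRingsF 3).2 = [true, true, true, true] := by
  fin_cases i <;> simp [testsRingsF]

end Summit.NavierStokesRegularity.FluidComputer.RingAperture

end
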